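import Mathlib
import Literature.NumberTheory.Automorphic.HilbertModularFormQExpansion
import Summits.Langlands.Langlands.Theorems.CapacityClassicalityHilbertIntegralOverconvergentIsCongruenceKoecherGlue
import Summits.Langlands.Langlands.Theorems.CapacityClassicalityHilbertIntegralOverconvergentIsCongruenceStubCubeIntegralTranslate
import Summits.Langlands.Langlands.Theorems.CapacityClassicalityHilbertIntegralOverconvergentIsCongruenceStubStripIdentity
import Summits.Langlands.Langlands.Theorems.CapacityClassicalityHilbertIntegralOverconvergentIsCongruenceStubEqOfForallSegment
import Summits.Langlands.Langlands.Theorems.CapacityClassicalityHilbertIntegralOverconvergentIsCongruenceStubTotallyRealEmbeddings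

/-!
# The Fourier coefficient `a_ν(y)` of a periodic holomorphic `f` does not depend on the height `y`

Stub `stub_fourierCoeffAt_indep` (L4) of line Sketch-ideate-r1-k1 for the crux
`HilbertIntegralOverconvergentIsCongruence` (stmt-Langlands-8485), section K (Götzky–Koecher at the cusp
`∞`): Freitag, *Hilbert Modular Forms*, Ch. I Lemma 4.1 — for `F` totally real, `f` holomorphic and
`𝓞 F`-periodic on the tube `ℍ^{Hom(F,ℝ)}` and `ν` in the dual lattice, the cube integral
`a_ν(y) = ∫_{[0,1]^ι} f(x+iy) e^{-2πi S(ν(x+iy))} dx = HilbertModular.fourierCoeffAt f ν y` is the same at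
all heights `y, y' ≫ 0`.

Proof (composition of the landed stubs K-A1, K-B, K-C, K-D and the glue of `…KoecherGlue.lean`): put
`H(z) = f(z) e^{-2πi S(νz)}`, holomorphic on `ℍ`.  For a height `y ≫ 0` and a real direction `v`, write
`v = realPoint w` (K-D (ii)) and consider `Ψ(s) = ∫ H(x + iy + s v) dx` on a small disc `‖s‖ < δ`: for real
`s` the shift is a translation `x ↦ x + s w` of the cube coordinates, under which the cube integral of the
`ℤ^ι`-periodic integrand is invariant (K-A1 with `koe_integrand_periodic`), so `Ψ` is constant on the real
diameter, hence on the disc (K-B); on the imaginary axis `s = it` this says `a_ν(y + t v) = a_ν(y)`.  Thus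
`a_ν` is locally constant along every line in the convex cone of heights, hence constant there (K-C).
-/

set_option linter.dupNamespace false

noncomputable section

namespace Summit.Langlands.Langlands.Theorems.HilbertIntegralOverconvergentIsCongruence

open MeasureTheory Complex NumberField
open Literature.NumberTheory.Automorphic Literature.NumberTheory.Automorphic.HilbertModular

/-- The kernel `H(z) = f(z) e^{-2πi S(νz)}` of the Fourier coefficient is holomorphic on `ℍ` when `f` is. -/
theorem fci_differentiableOn_kernel {F : Type} [Field F] [NumberField F] (f : Point F → ℂ)
    (hf : IsHolomorphicOn F f) (ν : F) :
    DifferentiableOn ℂ (fun z : Point F ↦ f z * cexp (-(2 * Real.pi * I * pairing ν z)))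
      (halfSpace F) := by
  refine hf.mul (Differentiable.differentiableOn ?_)
  simp only [pairing]
  fun_prop

/-- Points `x + iy + s·v` (`v` a real direction, `s` complex with `‖s‖ ≤ δ`) stay in `ℍ` as soon as
`δ · ∑_σ |v_σ| ≤ m / 2` for a positive lower bound `m` of the heights `y_σ`. -/
theorem fci_cubePoint_add_smul_mem_halfSpace {F : Type} [Field F] [NumberField F] (x : Coord F)
    {y v : (F →+* ℝ) → ℝ} {m δ : ℝ} (hm : 0 < m) (hmy : ∀ σ, m ≤ y σ) (hδ : 0 ≤ δ)
    (hδV : δ * ∑ σ, |v σ| ≤ m / 2) {s : ℂ} (hs : ‖s‖ ≤ δ) :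
    cubePoint x y + s • (fun σ ↦ ((v σ : ℝ) : ℂ)) ∈ halfSpace F := by
  intro σ
  show 0 < ((cubePoint x y + s • fun σ ↦ ((v σ : ℝ) : ℂ)) σ).im
  simp only [Pi.add_apply, Pi.smul_apply, smul_eq_mul, Complex.add_im, koe_cubePoint_im,
    Complex.mul_im, Complex.ofReal_re, Complex.ofReal_im, mul_zero]
  have hVσ : |v σ| ≤ ∑ σ, |v σ| :=
    Finset.single_le_sum (f := fun σ ↦ |v σ|) (fun _ _ ↦ abs_nonneg _) (Finset.mem_univ σ)
  have h1 : |s.im * v σ| ≤ δ * ∑ σ, |v σ| := by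
    rw [abs_mul]
    exact mul_le_mul ((Complex.abs_im_le_norm s).trans hs) hVσ (abs_nonneg _) hδ
  have h2 : -(δ * ∑ σ, |v σ|) ≤ s.im * v σ := by linarith [neg_abs_le (s.im * v σ)]
  linarith [hmy σ]

/-- **Local constancy of `a_ν` along a direction.**  For `y ≫ 0` and any real direction `v` there is
`δ > 0` with `a_ν(y + t v) = a_ν(y)` for `|t| < δ`: the cube-parametric integral
`Ψ(s) = ∫ H(x + iy + s v) dx` is constant on the real diameter of the disc `‖s‖ < δ` (translation
invariance of the cube integral of the periodic integrand, K-A1, the direction being `v = realPoint w`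
by K-D), hence on the disc (K-B), and `s = it` is the height shift. -/
theorem fci_fourierCoeffAt_locally_const (F : Type) [Field F] [NumberField F] [NumberField.IsTotallyReal F]
    (f : Point F → ℂ) (hf : IsHolomorphicOn F f)
    (hper : ∀ (a : 𝓞 F) (z : Point F), z ∈ halfSpace F → f (fun σ ↦ z σ + ((σ (a : F) : ℝ) : ℂ)) = f z)
    (ν : F) (hν : ∀ a : 𝓞 F, ∃ n : ℤ, Algebra.trace ℚ F (ν * a) = n)
    (y : (F →+* ℝ) → ℝ) (hy : ∀ σ, 0 < y σ) (v : (F →+* ℝ) → ℝ) :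
    ∃ δ > 0, ∀ t : ℝ, |t| < δ → fourierCoeffAt f ν (y + t • v) = fourierCoeffAt f ν y := by
  obtain ⟨htr, hsurj⟩ := stub_totallyReal_embeddings F
  have hper' : ∀ (a : 𝓞 F) (z : Point F), (∀ σ, 0 < (z σ).im) →
      f (fun σ ↦ z σ + ((σ (a : F) : ℝ) : ℂ)) = f z :=
    fun a z hz ↦ hper a z (mem_halfSpace_iff.2 hz)
  -- the kernel `H(z) = f(z) e^{-2πi S(νz)}`, holomorphic on the tube
  set H : Point F → ℂ := fun z ↦ f z * cexp (-(2 * Real.pi * I * pairing ν z)) with hHdef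
  have hH : DifferentiableOn ℂ H (halfSpace F) := fci_differentiableOn_kernel f hf ν
  -- the direction `v = realPoint w`, a lower bound `m` for the heights, the radius `δ`
  obtain ⟨w, hw⟩ := hsurj v
  obtain ⟨m, hm, hmy⟩ := koe_exists_pos_le y hy
  set V : ℝ := ∑ σ, |v σ| with hV
  have hV0 : 0 ≤ V := Finset.sum_nonneg fun _ _ ↦ abs_nonneg _
  set δ : ℝ := m / (2 * (1 + V)) with hδ
  have hδpos : 0 < δ := by positivity
  have hδV : δ * V ≤ m / 2 := by
    rw [hδ, div_mul_eq_mul_div, div_le_div_iff₀ (by positivity) (by positivity)]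
    nlinarith
  -- the direction in `ℂ^{Hom(F,ℝ)}` and the base points
  set u : Point F := fun σ ↦ ((v σ : ℝ) : ℂ) with hu
  set p : Coord F → Point F := fun x ↦ cubePoint x y with hp
  have hmem : ∀ x ∈ Set.Icc (0 : Coord F) 1, ∀ s : ℂ, ‖s‖ ≤ δ → p x + s • u ∈ halfSpace F :=
    fun x _ s hs ↦ fci_cubePoint_add_smul_mem_halfSpace x hm hmy hδpos.le hδV hs
  -- constancy on the real diameter: K-A1 for the periodic integrand
  have hreal : ∀ s : ℝ, |s| < δ →
      ∫ x in Set.Icc (0 : Coord F) 1, H (p x + (s : ℂ) • u) = ∫ x in Set.Icc (0 : Coord F) 1, H (p x) := by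
    intro s _
    have hshift : ∀ x, p x + (s : ℂ) • u = cubePoint (x + s • w) y := by
      intro x
      rw [koe_cubePoint_add_smul]
      funext σ
      simp only [hp, hu, Pi.add_apply, Pi.smul_apply, smul_eq_mul, ← hw, realPoint]
    simp_rw [hshift]
    exact stub_cubeIntegral_translate (fun x ↦ H (cubePoint x y))
      (koe_integrand_periodic htr f hper' hν hy) (s • w)
  -- constancy on the disc: K-B
  have key := stub_stripIdentity H (halfSpace F) isOpen_halfSpace hH p (koe_continuous_cubePoint y) u δ
    hδpos hmem hreal
  refine ⟨δ, hδpos, fun t ht ↦ ?_⟩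
  have hnorm : ‖((t : ℂ) * I)‖ < δ := by simpa using ht
  have k := key ((t : ℂ) * I) hnorm
  have hshift : ∀ x, p x + ((t : ℂ) * I) • u = cubePoint x (y + t • v) := by
    intro x
    rw [koe_cubePoint_height_add]
    funext σ
    simp only [hp, hu, Pi.add_apply, Pi.smul_apply, smul_eq_mul]
  simp_rw [hshift] at k
  exact k

/-- **Stub L4 — `stub_fourierCoeffAt_indep` (Freitag I.4.1, the part of the Fourier expansion theorem
needed by section K).**  For `F` totally real, `f` holomorphic and `𝓞 F`-periodic on `ℍ`, and `ν` in the
dual lattice, the Fourier coefficient `HilbertModular.fourierCoeffAt f ν y` does not depend on the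
height: `a_ν(y) = a_ν(y')` for all `y, y' ≫ 0` (local constancy along lines,
`fci_fourierCoeffAt_locally_const`, upgraded to constancy on the convex cone of heights by K-C). -/
theorem stub_fourierCoeffAt_indep (F : Type) [Field F] [NumberField F] [NumberField.IsTotallyReal F]
    (f : Point F → ℂ) (hf : IsHolomorphicOn F f)
    (hper : ∀ (a : 𝓞 F) (z : Point F), z ∈ halfSpace F → f (fun σ ↦ z σ + ((σ (a : F) : ℝ) : ℂ)) = f z)
    (ν : F) (hν : ∀ a : 𝓞 F, ∃ n : ℤ, Algebra.trace ℚ F (ν * a) = n)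
    (y y' : (F →+* ℝ) → ℝ) (hy : ∀ σ, 0 < y σ) (hy' : ∀ σ, 0 < y' σ) :
    fourierCoeffAt f ν y = fourierCoeffAt f ν y' :=
  stub_eq_of_forall_segment {y | ∀ σ, 0 < y σ} koe_convex_heights (fourierCoeffAt f ν)
    (fun y₀ hy₀ v ↦ by
      obtain ⟨δ, hδ, h⟩ := fci_fourierCoeffAt_locally_const F f hf hper ν hν y₀ hy₀ v
      exact ⟨δ, hδ, fun t ht _ ↦ h t ht⟩)
    hy hy'

end Summit.Langlands.Langlands.Theorems.HilbertIntegralOverconvergentIsCongruence
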